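import Summits.Parity.GeneralizedHardyLittlewood.Theorems.LiouvilleShiftedTablesTypeI2DilatedMainTerms6

/-!
# Main terms of the line `peel-to-drappeau` (crux `TypeI2Dilated`, stmt-Parity-14272) — VII: the raw total

All blocks of `DilatedMainTerms` together.  The blocks are indexed by the triples `τ = (P, (q, r))` of a finite
family `T` (positive coordinates, moduli `L_τ = lcm(q, rP) ≤ X₂`); for each, `mainBlock_le` produces a class
`e_τ` and the reduced block `Φ_τ(e_τ)`, which is split into the ranges (i) (`range_i_le`), (ii)
(`range_ii_total_le`, summed over the family against an abstract family bound `hfam` of value `B`) and (iii)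
(`range_iii_tau_le`); the sums over `τ` of the (i)/(iii) bounds go through the modulus
(`MainTermsAux.sum_triples_le`).  Result (`total_raw_le`):

`∑_{τ ∈ T} ‖block_τ‖ ≤ K² W² ((N/D₀) S₃ + #T) + F₀³ W (7 + 12 log D₀) B + (330000 W ℓ / F₀) S₅`,

`N = ⌊Y⌋`, `K = ⌊Rd⌋`, `S₃ = ∑_{L ≤ X₂} σ₀(L)³/L`,
`S₅ = ∑_{L ≤ X₂} σ₀(L)³ σ₀(L)² (D₀ (2 + E) + N (1 + log D₀)/φ(L))`, `E`, `ℓ` the bracket data of file VI.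
The final file turns this into `C x/(log x)^A`.  [this line: Lines/peel-to-drappeau.md]
-/

noncomputable section

namespace Summit.Parity.GeneralizedHardyLittlewood.Cruxes.TypeI2Dilated.PeelToDrappeau

open Finset Real Complex
open scoped ArithmeticFunction.sigma Classical
open Literature.NumberTheory.Sieve Literature.NumberTheory.Sieve.Drappeau2017 LiouvilleMV
open ArithmeticFunction (liouville)

/-- **The raw total.**  See the module docstring. [this line] -/
theorem total_raw_le (c : ℤ) (u v : ℕ → ℤ) (Slo S Y Rd : ℝ) (hRd : 1 ≤ Rd) (T : Finset (ℕ × ℕ × ℕ))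
    (hT : ∀ τ ∈ T, 0 < τ.1 ∧ 0 < τ.2.1 ∧ 0 < τ.2.2) {X₂ : ℕ}
    (hX₂ : ∀ τ ∈ T, Nat.lcm τ.2.1 (τ.2.2 * τ.1) ≤ X₂) {F₀ D₀ : ℕ} (hF₀ : 0 < F₀) (hD₀ : 0 < D₀)
    {W : ℝ} (hW : 0 ≤ W) (hWτ : ∀ τ ∈ T, weightW (S / τ.1) ≤ W) {X B : ℝ} (hB : 0 ≤ B)
    (hNX : (⌊Y⌋₊ : ℝ) ≤ X)
    (hMX : ∀ τ ∈ T, ((Nat.lcm τ.2.1 (τ.2.2 * τ.1) * F₀ : ℕ) : ℝ) ≤ X ^ (1 / 4 : ℝ))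
    (hfam : ∀ (M z H : ℕ × ℕ × ℕ → ℕ),
      (∀ τ ∈ T, 1 ≤ M τ ∧ (M τ : ℝ) ≤ X ^ (1 / 4 : ℝ) ∧ (H τ : ℝ) ≤ X) →
      (∀ m : ℕ, ((T.filter (fun τ => M τ = m)).card : ℝ) ≤ (σ 0 m : ℝ) ^ 3) →
        ∑ τ ∈ T, |∑ t ∈ (Icc 1 (H τ)).filter (fun t : ℕ => (t : ZMod (M τ)) = ((z τ : ℕ) : ZMod (M τ))),
          (liouville t : ℝ)| ≤ B) :
    ∑ τ ∈ T, ‖∑ s ∈ sRange c τ.2.1 (τ.2.2 * τ.1) (Slo / τ.1) (S / τ.1),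
        ∑ m ∈ (Icc 1 ⌊Y⌋₊).filter (fun m : ℕ =>
            (m : ZMod (τ.2.2 * τ.1)) = ((u (τ.2.2 * τ.1) : ℤ) : ZMod (τ.2.2 * τ.1)) ∧
              (m : ZMod τ.2.1) = ((v τ.2.1 : ℤ) : ZMod τ.2.1)),
          ((liouville m : ℤ) : ℂ) * mainKernel Rd s ((m : ZMod s) * ((c : ZMod s))⁻¹)‖ ≤
      (⌊Rd⌋₊ : ℝ) ^ 2 * W ^ 2 * ((⌊Y⌋₊ : ℝ) / D₀ * ∑ L ∈ Icc 1 X₂, (σ 0 L : ℝ) ^ 3 * (1 / (L : ℝ)) +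
          T.card) +
        (F₀ : ℝ) ^ 3 * W * (7 + 12 * Real.log D₀) * B +
        330000 * W * Real.log ((2 + ⌊Y⌋₊ : ℝ) * (⌊Rd⌋₊ * X₂ : ℕ)) ^ 4 / F₀ *
          ∑ L ∈ Icc 1 X₂, (σ 0 L : ℝ) ^ 3 * ((σ 0 L : ℝ) ^ 2 *
            (D₀ * (2 + (((2 + ⌊Y⌋₊ : ℝ) ^ (5 / 6 : ℝ) * (⌊Rd⌋₊ * X₂ : ℕ) +
              (2 + ⌊Y⌋₊ : ℝ) ^ (1 / 2 : ℝ) * ((⌊Rd⌋₊ * X₂ : ℕ) : ℝ) ^ 2) * (1 + Real.log (2 + ⌊Y⌋₊ : ℝ)))) +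
              ⌊Y⌋₊ / Nat.totient L * (1 + Real.log D₀))) := by
  -- notation
  set N := ⌊Y⌋₊ with hN
  set K := ⌊Rd⌋₊ with hK
  have hK1 : 1 ≤ K := Nat.le_floor (by simpa using hRd)
  set E : ℝ := ((2 + N : ℝ) ^ (5 / 6 : ℝ) * (K * X₂ : ℕ) + (2 + N : ℝ) ^ (1 / 2 : ℝ) *
    ((K * X₂ : ℕ) : ℝ) ^ 2) * (1 + Real.log (2 + N : ℝ)) with hE
  set ℓ : ℝ := Real.log ((2 + N : ℝ) * (K * X₂ : ℕ)) ^ 4 with hℓ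
  -- the classes `e_τ`
  choose e he using fun τ : ℕ × ℕ × ℕ =>
    mainBlock_le c τ.2.1 (τ.2.2 * τ.1) (u (τ.2.2 * τ.1)) (v τ.2.1) (Slo / τ.1) (S / τ.1) Y Rd
  -- the three pieces per triple
  set Ai : (ℕ × ℕ × ℕ) → ℝ := fun τ => ∑ p ∈ primIndexLe K,
    ∑ d ∈ (Icc 1 ⌊S / τ.1⌋₊).filter (fun d => D₀ < d),
      omegaW c τ.2.1 (τ.2.2 * τ.1) (Slo / τ.1) (S / τ.1) p.1 d *
        classCharNorm (Nat.lcm τ.2.1 (τ.2.2 * τ.1)) (e τ) p d N with hAi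
  set Aii : (ℕ × ℕ × ℕ) → ℝ := fun τ => ∑ p ∈ (primIndexLe K).filter (fun p => p.1 ≤ F₀),
    ∑ d ∈ (Icc 1 ⌊S / τ.1⌋₊).filter (fun d => d ≤ D₀),
      omegaW c τ.2.1 (τ.2.2 * τ.1) (Slo / τ.1) (S / τ.1) p.1 d *
        classCharNorm (Nat.lcm τ.2.1 (τ.2.2 * τ.1)) (e τ) p d N with hAii
  set Aiii : (ℕ × ℕ × ℕ) → ℝ := fun τ => ∑ d ∈ (Icc 1 ⌊S / τ.1⌋₊).filter (fun d => d ≤ D₀),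
    ∑ p ∈ (primIndexLe K).filter (fun p => F₀ < p.1),
      omegaW c τ.2.1 (τ.2.2 * τ.1) (Slo / τ.1) (S / τ.1) p.1 d *
        classCharNorm (Nat.lcm τ.2.1 (τ.2.2 * τ.1)) (e τ) p d N with hAiii
  -- Step 1: each block is at most `Ai + Aii + Aiii`
  have hsplit : ∀ τ ∈ T, ‖∑ s ∈ sRange c τ.2.1 (τ.2.2 * τ.1) (Slo / τ.1) (S / τ.1),
      ∑ m ∈ (Icc 1 N).filter (fun m : ℕ =>
          (m : ZMod (τ.2.2 * τ.1)) = ((u (τ.2.2 * τ.1) : ℤ) : ZMod (τ.2.2 * τ.1)) ∧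
            (m : ZMod τ.2.1) = ((v τ.2.1 : ℤ) : ZMod τ.2.1)),
        ((liouville m : ℤ) : ℂ) * mainKernel Rd s ((m : ZMod s) * ((c : ZMod s))⁻¹)‖ ≤
      Ai τ + Aii τ + Aiii τ := by
    intro τ _
    refine (he τ).trans (le_of_eq ?_)
    rw [sum_sum_split_three (primIndexLe K) (Icc 1 ⌊S / τ.1⌋₊)
      (fun p d => omegaW c τ.2.1 (τ.2.2 * τ.1) (Slo / τ.1) (S / τ.1) p.1 d *
        classCharNorm (Nat.lcm τ.2.1 (τ.2.2 * τ.1)) (e τ) p d N) (fun p => p.1 ≤ F₀) D₀]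
    simp only [hAi, hAii, hAiii]
    congr 1
    rw [sum_comm]
    refine sum_congr rfl fun d _ => sum_congr ?_ fun _ _ => rfl
    exact filter_congr fun p _ => not_le
  refine (sum_le_sum hsplit).trans ?_
  rw [sum_add_distrib, sum_add_distrib]
  -- Step 2: range (i)
  have hcardK := MainTermsAux.card_primIndexLe_le K
  have hAi_le : ∀ τ ∈ T, Ai τ ≤ (K : ℝ) ^ 2 * (W ^ 2 *
      ((N : ℝ) / (D₀ * Nat.lcm τ.2.1 (τ.2.2 * τ.1)) + 1)) := by
    intro τ hτ
    obtain ⟨hP, hq, hr⟩ := hT τ hτ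
    have h := range_i_le c hq (Nat.mul_pos hr hP) (Slo / τ.1) (S / τ.1) (e τ) K hD₀ N
    refine h.trans ?_
    have hWτ' := hWτ τ hτ
    have hW0 := weightW_nonneg' (S / τ.1)
    have hX : 0 ≤ (N : ℝ) / (D₀ * Nat.lcm τ.2.1 (τ.2.2 * τ.1)) + 1 := by positivity
    calc ((primIndexLe K).card : ℝ) * (weightW (S / τ.1) ^ 2 *
          ((N : ℝ) / (D₀ * Nat.lcm τ.2.1 (τ.2.2 * τ.1)) + 1))
        ≤ (K : ℝ) ^ 2 * (weightW (S / τ.1) ^ 2 * ((N : ℝ) / (D₀ * Nat.lcm τ.2.1 (τ.2.2 * τ.1)) + 1)) :=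
          mul_le_mul_of_nonneg_right hcardK (by positivity)
      _ ≤ (K : ℝ) ^ 2 * (W ^ 2 * ((N : ℝ) / (D₀ * Nat.lcm τ.2.1 (τ.2.2 * τ.1)) + 1)) := by
          gcongr
  have hsumi : ∑ τ ∈ T, Ai τ ≤ (K : ℝ) ^ 2 * W ^ 2 *
      ((N : ℝ) / D₀ * ∑ L ∈ Icc 1 X₂, (σ 0 L : ℝ) ^ 3 * (1 / (L : ℝ)) + T.card) := by
    refine (sum_le_sum hAi_le).trans ?_
    rw [← mul_sum, mul_assoc]
    refine mul_le_mul_of_nonneg_left ?_ (by positivity)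
    rw [← mul_sum]
    refine mul_le_mul_of_nonneg_left ?_ (by positivity)
    rw [sum_add_distrib, sum_const, nsmul_eq_mul, mul_one]
    refine add_le_add ?_ le_rfl
    have h3 := MainTermsAux.sum_triples_le T hT hX₂ (h := fun L => 1 / (L : ℝ)) fun L => by positivity
    calc ∑ τ ∈ T, (N : ℝ) / (D₀ * Nat.lcm τ.2.1 (τ.2.2 * τ.1))
        = (N : ℝ) / D₀ * ∑ τ ∈ T, 1 / (Nat.lcm τ.2.1 (τ.2.2 * τ.1) : ℝ) := by
          rw [mul_sum]
          refine sum_congr rfl fun τ _ => ?_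
          rw [div_mul_div_comm, mul_one]
      _ ≤ (N : ℝ) / D₀ * ∑ L ∈ Icc 1 X₂, (σ 0 L : ℝ) ^ 3 * (1 / (L : ℝ)) :=
          mul_le_mul_of_nonneg_left h3 (by positivity)
  -- Step 3: range (ii)
  have hsumii : ∑ τ ∈ T, Aii τ ≤ (F₀ : ℝ) ^ 3 * W * (7 + 12 * Real.log D₀) * B :=
    range_ii_total_le c Slo S N F₀ K D₀ T hT e hW hWτ hB hNX hMX hfam
  -- Step 4: range (iii)
  have hℓ0 : 0 ≤ ℓ := by
    simp only [hℓ]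
    rcases Nat.eq_zero_or_pos X₂ with h0 | hpos
    · simp [h0]
    · refine pow_nonneg (Real.log_nonneg ?_) 4
      have h1 : (1 : ℝ) ≤ (K * X₂ : ℕ) := by exact_mod_cast Nat.mul_pos hK1 hpos
      have h2 : (1 : ℝ) ≤ 2 + N := by linarith [(Nat.cast_nonneg N : (0 : ℝ) ≤ N)]
      exact one_le_mul_of_one_le_of_one_le h2 h1
  have hE0 : 0 ≤ E := by
    simp only [hE]
    have : 0 ≤ Real.log (2 + N : ℝ) := Real.log_nonneg (by linarith [(Nat.cast_nonneg N : (0 : ℝ) ≤ N)])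
    positivity
  have hlogD : 0 ≤ 1 + Real.log (D₀ : ℝ) := by
    have := Real.log_natCast_nonneg D₀; linarith
  set h5 : ℕ → ℝ := fun L => (σ 0 L : ℝ) ^ 2 * (D₀ * (2 + E) + N / Nat.totient L * (1 + Real.log D₀))
    with hh5
  have hh5nn : ∀ L, 0 ≤ h5 L := fun L => by simp only [hh5]; positivity
  have hAiii_le : ∀ τ ∈ T, Aiii τ ≤ 330000 * W * ℓ / F₀ * h5 (Nat.lcm τ.2.1 (τ.2.2 * τ.1)) := by
    intro τ hτ
    obtain ⟨hP, hq, hr⟩ := hT τ hτ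
    have hL : 0 < Nat.lcm τ.2.1 (τ.2.2 * τ.1) := Nat.lcm_pos hq (Nat.mul_pos hr hP)
    have h := range_iii_tau_le c hL (Nat.lcm_dvd_mul _ _) (Slo / τ.1) (S / τ.1) (e τ) hF₀ hK1
      (hX₂ τ hτ) D₀ N
    refine h.trans ?_
    have hWτ' := hWτ τ hτ
    have hW0 := weightW_nonneg' (S / τ.1)
    have hF₀0 : (0 : ℝ) < F₀ := by exact_mod_cast hF₀
    simp only [hh5]
    rw [show 330000 * weightW (S / τ.1) * (σ 0 (Nat.lcm τ.2.1 (τ.2.2 * τ.1)) : ℝ) ^ 2 * ℓ / F₀ *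
        (D₀ * (2 + E) + N / Nat.totient (Nat.lcm τ.2.1 (τ.2.2 * τ.1)) * (1 + Real.log D₀)) =
        weightW (S / τ.1) * (330000 * ℓ / F₀ * ((σ 0 (Nat.lcm τ.2.1 (τ.2.2 * τ.1)) : ℝ) ^ 2 *
          (D₀ * (2 + E) + N / Nat.totient (Nat.lcm τ.2.1 (τ.2.2 * τ.1)) * (1 + Real.log D₀)))) by ring,
      show 330000 * W * ℓ / F₀ * ((σ 0 (Nat.lcm τ.2.1 (τ.2.2 * τ.1)) : ℝ) ^ 2 *
        (D₀ * (2 + E) + N / Nat.totient (Nat.lcm τ.2.1 (τ.2.2 * τ.1)) * (1 + Real.log D₀))) =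
        W * (330000 * ℓ / F₀ * ((σ 0 (Nat.lcm τ.2.1 (τ.2.2 * τ.1)) : ℝ) ^ 2 *
          (D₀ * (2 + E) + N / Nat.totient (Nat.lcm τ.2.1 (τ.2.2 * τ.1)) * (1 + Real.log D₀)))) by ring]
    exact mul_le_mul_of_nonneg_right hWτ' (by positivity)
  have hsumiii : ∑ τ ∈ T, Aiii τ ≤ 330000 * W * ℓ / F₀ * ∑ L ∈ Icc 1 X₂, (σ 0 L : ℝ) ^ 3 * h5 L := by
    refine (sum_le_sum hAiii_le).trans ?_
    rw [← mul_sum]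
    have hF₀0 : (0 : ℝ) < F₀ := by exact_mod_cast hF₀
    exact mul_le_mul_of_nonneg_left (MainTermsAux.sum_triples_le T hT hX₂ hh5nn) (by positivity)
  -- conclusion
  have := add_le_add (add_le_add hsumi hsumii) hsumiii
  simpa only [hh5, hE, hℓ] using this

/-- Landing anchor of the main-terms chain, file 7; registered stub `mainTermsChain7_anchor`. -/
theorem mainTermsChain7_anchor : True := trivial

end Summit.Parity.GeneralizedHardyLittlewood.Cruxes.TypeI2Dilated.PeelToDrappeau

end
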